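import Mathlib.Analysis.Analytic.Constructions
import Mathlib.Analysis.Analytic.Linear
import Mathlib.Analysis.Analytic.Uniqueness
import Mathlib.Topology.MetricSpace.Pseudo.Pi
import Literature.ModelTheory.ExponentialFields.Semialgebraic
import Literature.ModelTheory.ExponentialFields.TarskiSeidenbergProofs
import Literature.NumberTheory.Transcendental.SemialgebraicMapsProofs
import HarnessLib

/-!
# Interior, closure and nowhere density of real semialgebraic sets

Topological facts on `k`-semialgebraic subsets of `ℝ ^ m` (coefficient ring `k` with an algebra
map `k → ℝ`, as in `Literature/ModelTheory/ExponentialFields/Semialgebraic.lean`), all proved: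

* `Literature.ModelTheory.ExponentialFields.isSemialgebraic_interior`,
  `Literature.ModelTheory.ExponentialFields.isSemialgebraic_closure` — the interior and the closure
  of a `k`-semialgebraic set are `k`-semialgebraic (Bochnak–Coste–Roy 1998, Prop. 2.2.2;
  Basu–Pollack–Roy 2006, Prop. 3.1): the interior is
  `{x | ∃ r > 0, ∀ y, ‖y - x‖² < r → y ∈ s}`, a first-order description realised by two
  applications of the (proved) Tarski–Seidenberg projection theorem
  `Literature.ModelTheory.ExponentialFields.tarski_seidenberg_real_holds`, the polynomial
  `∑ (yᵢ - xᵢ)² - r` having integer coefficients.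
* `Literature.ModelTheory.ExponentialFields.interior_setOf_aeval_eq_zero` — the zero set of a
  polynomial over `k` which does not vanish identically on `ℝ ^ ι` has empty interior (identity
  principle for the real-analytic function `x ↦ p(x)` on the connected space `ℝ ^ ι`).
* `Literature.ModelTheory.ExponentialFields.IsSemialgebraic.subset_interior_union` and
  `Literature.ModelTheory.ExponentialFields.IsSemialgebraic.interior_closure_eq_empty` — a
  `k`-semialgebraic set is contained in the union of its interior and of finitely many zero sets of
  not-identically-vanishing polynomials over `k` (sign-condition normal form: a point at which no
  non-trivial polynomial of the describing family vanishes has a neighbourhood with the same sign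
  vector); hence a semialgebraic set with empty interior is nowhere dense (Bochnak–Coste–Roy 1998,
  §2.8: a semialgebraic set has empty interior iff it has dimension `< m`, iff it lies in a proper
  algebraic subset).

These are the topological inputs of the discharge of
`Literature.NumberTheory.Transcendental.IsSemialgebraicFunOn.exists_contDiffOn`
(`Literature/NumberTheory/Transcendental/SemialgebraicMapsSmoothProofs.lean`).

## References

* J. Bochnak, M. Coste, M.-F. Roy, *Real Algebraic Geometry*, Ergebnisse 36, Springer (1998),
  Prop. 2.2.2 (closure and interior of semialgebraic sets), §2.8 (dimension).
* S. Basu, R. Pollack, M.-F. Roy, *Algorithms in Real Algebraic Geometry*, 2nd ed., Springer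
  (2006), Prop. 3.1 (closure of a semi-algebraic set), Thm. 2.76 (projection theorem),
  Prop. 2.27 / Def. 2.25 (sign conditions).

## Design notes

* No new definitions. The interior/closure statements are for subsets of `Fin m → ℝ` (the shape
  of the projection theorem in the tree); the zero-set and nowhere-density statements are for any
  finite index type.
-/

noncomputable section

open Set Filter MvPolynomial
open _root_.Topology

namespace Literature.ModelTheory.ExponentialFields

variable {k : Type*} [CommRing k] [Algebra k ℝ]

/-! ### Polynomial functions: continuity, analyticity, zero sets -/

section ZeroSets

/-- Polynomial functions `x ↦ p(x)` on `ι → ℝ` with coefficients in `k` are continuous.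
[folklore] -/
theorem continuous_aeval_real {ι : Type*} (p : MvPolynomial ι k) :
    Continuous fun x : ι → ℝ => aeval x p := by
  induction p using MvPolynomial.induction_on with
  | C a => simpa using continuous_const
  | add p q hp hq => simpa using hp.fun_add hq
  | mul_X p i hp => simpa using hp.fun_mul (continuous_apply i)

/-- Polynomial functions `x ↦ p(x)` on `ι → ℝ` (`ι` finite) with coefficients in `k` are real
analytic. [folklore] -/
theorem analyticOnNhd_aeval {ι : Type*} [Fintype ι] (p : MvPolynomial ι k) :
    AnalyticOnNhd ℝ (fun x : ι → ℝ => aeval x p) univ := by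
  induction p using MvPolynomial.induction_on with
  | C a => simpa using analyticOnNhd_const
  | add p q hp hq =>
    simp only [map_add]
    exact hp.add hq
  | mul_X p i hp =>
    have hX : AnalyticOnNhd ℝ (fun x : ι → ℝ => x i) univ :=
      (ContinuousLinearMap.proj (R := ℝ) (φ := fun _ : ι => ℝ) i).analyticOnNhd _
    simpa using hp.mul hX

/-- Zero sets of polynomials over `k` are closed in `ℝ ^ ι`. [folklore] -/
theorem isClosed_setOf_aeval_eq_zero {ι : Type*} (p : MvPolynomial ι k) :
    IsClosed {x : ι → ℝ | aeval x p = 0} :=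
  isClosed_eq (continuous_aeval_real p) continuous_const

/-- **Zero sets are thin.** If a polynomial `p` over `k` does not vanish identically on `ℝ ^ ι`
(`ι` finite), its zero set has empty interior: by the identity principle, the real-analytic function
`x ↦ p(x)` vanishing on a non-empty open subset of the connected space `ℝ ^ ι` vanishes everywhere.
[cite: BochnakCosteRoy1998, §2.8] -/
theorem interior_setOf_aeval_eq_zero {ι : Type*} [Fintype ι] (p : MvPolynomial ι k)
    (h : ∃ x : ι → ℝ, aeval x p ≠ 0) : interior {x : ι → ℝ | aeval x p = 0} = ∅ := by
  by_contra hne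
  obtain ⟨z₀, hz₀⟩ := nonempty_iff_ne_empty.mpr hne
  have hev : (fun x : ι → ℝ => aeval x p) =ᶠ[𝓝 z₀] 0 := by
    filter_upwards [mem_interior_iff_mem_nhds.mp hz₀] with x hx
    simpa using hx
  have hzero := (analyticOnNhd_aeval p).eqOn_zero_of_preconnected_of_eventuallyEq_zero
    isPreconnected_univ (mem_univ z₀) hev
  obtain ⟨x, hx⟩ := h
  exact hx (by simpa using hzero (mem_univ x))

/-- A finite union of closed sets with empty interior has empty interior. [folklore] -/
theorem interior_biUnion_finset_eq_empty {α β : Type*} [TopologicalSpace α] (S : Finset β)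
    (Z : β → Set α) (hc : ∀ b ∈ S, IsClosed (Z b)) (hi : ∀ b ∈ S, interior (Z b) = ∅) :
    interior (⋃ b ∈ S, Z b) = ∅ := by
  classical
  induction S using Finset.induction_on with
  | empty => simp
  | insert a S ha ih =>
    rw [Finset.set_biUnion_insert, interior_union_isClosed_of_interior_empty
      (hc a (Finset.mem_insert_self a S))
      (ih (fun b hb => hc b (Finset.mem_insert_of_mem hb))
        (fun b hb => hi b (Finset.mem_insert_of_mem hb)))]
    exact hi a (Finset.mem_insert_self a S)

end ZeroSets

/-! ### Semialgebraic sets with empty interior are nowhere dense -/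

section NowhereDense

/-- A `k`-semialgebraic set `s ⊆ ℝ ^ ι` is contained in the union of its interior and of finitely
many zero sets of polynomials over `k` none of which vanishes identically: writing `s` by sign
conditions on a finite family `Q`, a point of `s` at which no non-trivial member of `Q` vanishes has
a whole neighbourhood with the same sign vector, hence inside `s`.
[cite: BasuPollackRoy2006, Def. 2.25 and Prop. 2.27 (sign conditions)] -/
theorem IsSemialgebraic.subset_interior_union {ι : Type*} {s : Set (ι → ℝ)}
    (hs : IsSemialgebraic k s) :
    ∃ Q₀ : Finset (MvPolynomial ι k), (∀ q ∈ Q₀, ∃ x : ι → ℝ, aeval x q ≠ 0) ∧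
      s ⊆ interior s ∪ ⋃ q ∈ Q₀, {x | aeval x q = 0} := by
  classical
  obtain ⟨Q, T, rfl⟩ := hs.exists_eq_setOf_signVec_mem
  refine ⟨Q.filter fun q => ∃ x : ι → ℝ, aeval x q ≠ 0, fun q hq => (Finset.mem_filter.mp hq).2,
    fun x hx => ?_⟩
  by_cases hvan : ∃ q ∈ Q.filter (fun q => ∃ x : ι → ℝ, aeval x q ≠ 0), aeval x q = 0
  · obtain ⟨q, hq, hq0⟩ := hvan
    exact Or.inr (mem_biUnion hq hq0)
  push Not at hvan
  refine Or.inl (mem_interior_iff_mem_nhds.mpr ?_)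
  -- the neighbourhood of points with the same sign vector as `x`
  have hN : (⋂ q ∈ Q, {x' : ι → ℝ | SignType.sign (aeval x' q) = SignType.sign (aeval x q)}) ∈
      𝓝 x := by
    refine (biInter_finset_mem Q).mpr fun q hq => ?_
    by_cases hq0 : ∃ x : ι → ℝ, aeval x q ≠ 0
    · have hxq : aeval x q ≠ 0 := hvan q (Finset.mem_filter.mpr ⟨hq, hq0⟩)
      rcases hxq.lt_or_gt with hlt | hgt
      · rw [sign_neg hlt]
        have : {x' : ι → ℝ | SignType.sign (aeval x' q) = -1} = (fun x' => aeval x' q) ⁻¹' Iio 0 :=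
          Set.ext fun _ => sign_eq_neg_one_iff
        rw [this]
        exact (continuous_aeval_real q).continuousAt.preimage_mem_nhds (Iio_mem_nhds hlt)
      · rw [sign_pos hgt]
        have : {x' : ι → ℝ | SignType.sign (aeval x' q) = 1} = (fun x' => aeval x' q) ⁻¹' Ioi 0 :=
          Set.ext fun _ => sign_eq_one_iff
        rw [this]
        exact (continuous_aeval_real q).continuousAt.preimage_mem_nhds (Ioi_mem_nhds hgt)
    · push Not at hq0
      have : {x' : ι → ℝ | SignType.sign (aeval x' q) = SignType.sign (aeval x q)} = univ :=
        eq_univ_of_forall fun x' => by simp [hq0 x', hq0 x]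
      rw [this]
      exact univ_mem
  refine mem_of_superset hN fun x' hx' => ?_
  have heq : (fun q : Q => SignType.sign (aeval x' (q : MvPolynomial ι k))) =
      fun q : Q => SignType.sign (aeval x (q : MvPolynomial ι k)) := by
    funext q
    exact (mem_iInter₂.mp hx') q.1 q.2
  show (fun q : Q => SignType.sign (aeval x' (q : MvPolynomial ι k))) ∈ T
  rw [heq]
  exact hx

/-- **Semialgebraic sets with empty interior are nowhere dense**: if a `k`-semialgebraic
`s ⊆ ℝ ^ ι` (`ι` finite) has empty interior then so has its closure, `s` being contained in a
finite union of zero sets of non-trivial polynomials (a closed set with empty interior).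
[cite: BochnakCosteRoy1998, §2.8] -/
theorem IsSemialgebraic.interior_closure_eq_empty {ι : Type*} [Fintype ι] {s : Set (ι → ℝ)}
    (hs : IsSemialgebraic k s) (h : interior s = ∅) : interior (closure s) = ∅ := by
  obtain ⟨Q₀, hQ₀, hsub⟩ := hs.subset_interior_union
  rw [h, empty_union] at hsub
  have hcl : IsClosed (⋃ q ∈ Q₀, {x : ι → ℝ | aeval x q = 0}) :=
    isClosed_biUnion_finset fun q _ => isClosed_setOf_aeval_eq_zero q
  have hint : interior (⋃ q ∈ Q₀, {x : ι → ℝ | aeval x q = 0}) = ∅ :=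
    interior_biUnion_finset_eq_empty Q₀ _ (fun q _ => isClosed_setOf_aeval_eq_zero q)
      fun q hq => interior_setOf_aeval_eq_zero q (hQ₀ q hq)
  exact subset_empty_iff.mp
    (hint ▸ interior_mono (hcl.closure_subset_iff.mpr hsub))

/-- A `k`-semialgebraic set with empty interior is contained in a closed set with empty interior
(namely a finite union of zero sets of non-trivial polynomials over `k`).
[cite: BochnakCosteRoy1998, §2.8] -/
theorem IsSemialgebraic.exists_isClosed_superset {ι : Type*} [Fintype ι] {s : Set (ι → ℝ)}
    (hs : IsSemialgebraic k s) (h : interior s = ∅) :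
    ∃ F : Set (ι → ℝ), IsClosed F ∧ interior F = ∅ ∧ s ⊆ F :=
  ⟨closure s, isClosed_closure, hs.interior_closure_eq_empty h, subset_closure⟩

end NowhereDense

/-! ### Interior and closure of semialgebraic sets are semialgebraic -/

section Interior

variable {m : ℕ}

/-- Metric description of the interior in `ℝ ^ m` by the polynomial "ball" condition
`∑ (yⱼ - xⱼ)² < r`: `x ∈ interior s ↔ ∃ r > 0, ∀ y, ∑ (yⱼ - xⱼ)² < r → y ∈ s`. [folklore] -/
theorem mem_interior_iff_exists_sum_sq_lt {s : Set (Fin m → ℝ)} {x : Fin m → ℝ} :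
    x ∈ interior s ↔ ∃ r : ℝ, 0 < r ∧ ∀ y : Fin m → ℝ, ∑ j, (y j - x j) ^ 2 < r → y ∈ s := by
  constructor
  · intro hx
    obtain ⟨ε, hε, hball⟩ := Metric.mem_nhds_iff.mp (mem_interior_iff_mem_nhds.mp hx)
    refine ⟨ε ^ 2, by positivity, fun y hy => hball ?_⟩
    rw [Metric.mem_ball, dist_pi_lt_iff hε]
    intro j
    rw [Real.dist_eq]
    refine abs_lt_of_sq_lt_sq ?_ hε.le
    exact (Finset.single_le_sum (fun i _ => sq_nonneg (y i - x i)) (Finset.mem_univ j)).trans_lt hy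
  · rintro ⟨r, hr, h⟩
    refine mem_interior.mpr ⟨{y | ∑ j, (y j - x j) ^ 2 < r}, fun y hy => h y hy, ?_, by simpa⟩
    exact isOpen_lt (continuous_finsetSum _ fun j _ =>
      ((continuous_apply j).sub continuous_const).pow 2) continuous_const

/-- **The interior of a semialgebraic set is semialgebraic.** For a `k`-semialgebraic `s ⊆ ℝ ^ m`,
`interior s = {x | ∃ r > 0, ∀ y, ∑ (yⱼ - xⱼ)² < r → y ∈ s}` is the projection (forgetting `r`) of
`{(x, r) | r > 0} \ π {(x, r, y) | y ∉ s ∧ ∑ (yⱼ - xⱼ)² < r}`, semialgebraic by two applications of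
the Tarski–Seidenberg projection theorem.
[cite: BochnakCosteRoy1998, Prop. 2.2.2] [cite: BasuPollackRoy2006, Prop. 3.1] -/
theorem isSemialgebraic_interior {s : Set (Fin m → ℝ)} (hs : IsSemialgebraic k s) :
    IsSemialgebraic k (interior s) := by
  classical
  -- `E = {(x, r, y) | y ∉ s ∧ ∑ (yⱼ - xⱼ)² < r} ⊆ ℝ ^ ((m + 1) + m)`
  set E : Set (Fin (m + 1 + m) → ℝ) :=
    {w | w ∘ Fin.natAdd (m + 1) ∉ s ∧
      ∑ j : Fin m, (w (Fin.natAdd (m + 1) j) - w (Fin.castAdd m (Fin.castSucc j))) ^ 2 <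
        w (Fin.castAdd m (Fin.last m))} with hE
  have hB : IsSemialgebraic k {w : Fin (m + 1 + m) → ℝ |
      ∑ j : Fin m, (w (Fin.natAdd (m + 1) j) - w (Fin.castAdd m (Fin.castSucc j))) ^ 2 <
        w (Fin.castAdd m (Fin.last m))} := by
    have := isSemialgebraic_setOf_eval_lt (k := k) (R := ℝ)
      (∑ j : Fin m, (X (Fin.natAdd (m + 1) j) - X (Fin.castAdd m (Fin.castSucc j))) ^ 2 :
        MvPolynomial (Fin (m + 1 + m)) k) (X (Fin.castAdd m (Fin.last m)))
    simpa using this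
  have hEsa : IsSemialgebraic k E :=
    (hs.compl.preimage_comp (Fin.natAdd (m + 1))).inter hB
  -- `F = π E ⊆ ℝ ^ (m + 1)`, `G = {r > 0} \ F`, `interior s = π' G`
  have hF := hEsa.image_castAdd
  have hG : IsSemialgebraic k ({v : Fin (m + 1) → ℝ | 0 < v (Fin.last m)} \
      (fun w : Fin (m + 1 + m) → ℝ => fun i : Fin (m + 1) => w (Fin.castAdd m i)) '' E) := by
    refine IsSemialgebraic.diff ?_ hF
    simpa using isSemialgebraic_setOf_eval_pos (k := k) (R := ℝ)
      (X (Fin.last m) : MvPolynomial (Fin (m + 1)) k)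
  convert tarski_seidenberg_real_holds hG using 1
  ext x
  rw [mem_interior_iff_exists_sum_sq_lt]
  simp only [mem_image, Set.mem_sdiff, mem_setOf_eq]
  constructor
  · rintro ⟨r, hr, h⟩
    refine ⟨Fin.snoc x r, ⟨by simpa using hr, ?_⟩, funext fun i => by simp⟩
    rintro ⟨w, ⟨hw1, hw2⟩, hw3⟩
    apply hw1
    refine h _ ?_
    have hx : ∀ j : Fin m, w (Fin.castAdd m (Fin.castSucc j)) = x j := fun j => by
      simpa using congr_fun hw3 (Fin.castSucc j)
    have hr' : w (Fin.castAdd m (Fin.last m)) = r := by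
      simpa using congr_fun hw3 (Fin.last m)
    simpa only [hx, hr', Function.comp_apply] using hw2
  · rintro ⟨v, ⟨hv0, hvF⟩, rfl⟩
    refine ⟨v (Fin.last m), hv0, fun y hy => ?_⟩
    by_contra hys
    apply hvF
    refine ⟨Fin.append v y, ⟨?_, ?_⟩, funext fun i => by simp⟩
    · have : Fin.append v y ∘ Fin.natAdd (m + 1) = y := funext fun j => by simp
      rwa [this]
    · simpa using hy

/-- **The closure of a semialgebraic set is semialgebraic** (complement of the interior of the
complement). [cite: BochnakCosteRoy1998, Prop. 2.2.2] [cite: BasuPollackRoy2006, Prop. 3.1] -/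
theorem isSemialgebraic_closure {s : Set (Fin m → ℝ)} (hs : IsSemialgebraic k s) :
    IsSemialgebraic k (closure s) := by
  rw [closure_eq_compl_interior_compl]
  exact (isSemialgebraic_interior hs.compl).compl

/-- The frontier-type set `s \ interior s` of a semialgebraic set is semialgebraic and has empty
interior. [cite: BochnakCosteRoy1998, Prop. 2.2.2] -/
theorem isSemialgebraic_diff_interior {s : Set (Fin m → ℝ)} (hs : IsSemialgebraic k s) :
    IsSemialgebraic k (s \ interior s) ∧ interior (s \ interior s) = ∅ := by
  refine ⟨hs.diff (isSemialgebraic_interior hs), subset_empty_iff.mp fun x hx => ?_⟩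
  have h1 : interior (s \ interior s) ⊆ interior s := interior_mono Set.sdiff_subset
  exact (interior_subset hx).2 (h1 hx)

end Interior

end Literature.ModelTheory.ExponentialFields
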